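import Summits.CriticalPhenomena.PercolationContinuityZ3.Theorems.PercNearOneGluingNoHeavyQuantTwoBlobGateCell
import Summits.CriticalPhenomena.PercolationContinuityZ3.Theorems.PercNearOneGluingNoHeavyQuantFlowPieces
import Summits.CriticalPhenomena.PercolationContinuityZ3.Theorems.PercNearOneGluingNoHeavyQuantSDEC
import HarnessLib

/-!
# QUANT lane R8, T-DEC: THE SHAPE OF THE SINGLE-GATE CLOSURE, part 2 — the CONE form (a target above the mean) of the gated closure is FALSE
# (explicit witness, kernel; part 1 `…QuantSingleGateSingleLow`: the single-low branch)

builds on p205010 (kernel theorem, internal audit signed; external expert review pending)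

Support file (`--supports stmt-CriticalPhenomena-4575`), QUANT lane lead seat prim-quant-lead (gen 28), rung R8 of
`run/shared/lean/prim/quant/LADDER.md`.  Part 2 of 2: the witness laws are `private def`s (five explicit finitely supported laws), theorems with standard axioms, no sorries.  Companion of `…QuantSingleGateClosure`
(lead g28: `@[conjecture] LawDec.SingleGateConvClosed` — for ONE gate `q`, `gate_q μᵢ` top-affordable and DEC at all layers at floor `y` ⟹
`gate_q(μ₁ ∗ μ₂)` DEC at all layers at `y` — and its kernel reductions to `SDECConvClosed` / `FarTreeRow`); LEAD-NOTES-G28 N80, N85.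

(1) **`LawDec.decAtT_gate_lconv_singleLow`** — if the atom `0` is the ONLY low of the gated convolution `gate_q(μ₁ ∗ μ₂)` at `(t, j)`
(`t = q·(T₁ + T₂)` its mean; no charged atom `1 ≤ k ≤ j` with `2k < t`) and the gated factors are top-affordable at `y` (`y·Mᵢ ≤ q·Tᵢ`), then
`gate_q(μ₁ ∗ μ₂)` is `DECAtT y t j (M₁ + M₂)` — by typer g26's first-moment criterion `flowAtT_of_moment` (the gated convolution is
top-affordable at `y` and has mean `t`).  This is the single-low branch of `SingleGateConvClosed` (and of PM⁻ / arm-1 g38's route: lead g28 N80,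
1 368 exact LPs — the zero-direction SDEC rows are never used); it needs NO hypothesis on the factors beyond top-affordability.

(2) **`LawDec.not_gatedConv_coneForm`** — the cone form of the gated closure (free targets above the mean, ConvClosedT-style windows including
the layers at and above the factors' tops, top-affordability w.r.t. the targets) is FALSE for `q < 1`: with `y = 7/12`, `q = 3/4`,
`μ₁ = {3: 4/9, 4: 5/9}` (`gate_q μ₁ = {0: 1/4, 3: 1/3, 4: 5/12}`, target `T₁ = 8/3` = its mean) and `μ₂ = {1: 1/2, 3: 1/2}` (`gate_q μ₂ =
{0: 1/4, 1: 3/8, 3: 3/8}`, target `T₂ = 7/4` = its mean `3/2` PLUS `1/4`, certified at every layer of the window only because the atom `1` is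
point-self-sufficient, `2·1 ≥ 7/4`), at `j = 6`: every window hypothesis holds (`DECAtT` of `gate_q μ₁` at layers `3..6`, of `gate_q μ₂` at
layers `2..6`, all single-low capacity inequalities, two of them tight) but `gate_q(μ₁ ∗ μ₂) = {0: 1/4, 4: 1/6, 5: 5/24, 6: 1/6, 7: 5/24}` is NOT
`DECAtT (7/12) (8/3 + 7/4) 6 7` (single-low capacity `1051/3180 < 1113/3180`), although it IS DEC at its mean `25/6` at every layer.  So the
target surplus that point self-sufficiency buys does not pass through a common gate: `SingleGateConvClosed` must be (and is) stated AT THE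
MEANS; census (lead g28 exp12b, both factors boundary-pushed): targets at/below the means 8 435 / 0, above 4 / 3 581; the `q = 1` cone form
(`ConvClosedT`) is unaffected (2 500 / 0 with and without the TA cap).  All verdicts by typer g23's `decAtT_singleLow_iff` + the closed forms of
`capCoef` (arm-1 g38 `capCoef0_eq_heavy`, arm-2 g31 `capCoef_giant` / `capCoef_zero_mid_incompat`).

[this work]; nothing here is cited as a published result.  The gluing rows served [cite: KozmaNitzan2024, Conjecture 3 (p. 15)]; product
measure [cite: Grimmett1999, §1.3 p. 10].
-/

noncomputable section

namespace Summit.CriticalPhenomena.PercolationContinuityZ3.Theorems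

namespace Quant

open Finset

namespace LawDec

/-! ### (2) The cone form is false: the witness -/

/-- first factor of the witness: `μ₁ = {3: 4/9, 4: 5/9}`. -/
private def mu1 : ℕ → ℝ := fun k => if k = 3 then 4 / 9 else if k = 4 then 5 / 9 else 0
/-- second factor of the witness: `μ₂ = {1: 1/2, 3: 1/2}`. -/
private def mu2 : ℕ → ℝ := fun k => if k = 1 then 1 / 2 else if k = 3 then 1 / 2 else 0
/-- `gate_{3/4} μ₁ = {0: 1/4, 3: 1/3, 4: 5/12}`. -/
private def nu1 : ℕ → ℝ := fun k => if k = 0 then 1 / 4 else if k = 3 then 1 / 3 else if k = 4 then 5 / 12 else 0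
/-- `gate_{3/4} μ₂ = {0: 1/4, 1: 3/8, 3: 3/8}`. -/
private def nu2 : ℕ → ℝ := fun k => if k = 0 then 1 / 4 else if k = 1 then 3 / 8 else if k = 3 then 3 / 8 else 0
/-- `gate_{3/4}(μ₁ ∗ μ₂) = {0: 1/4, 4: 1/6, 5: 5/24, 6: 1/6, 7: 5/24}`. -/
private def pp : ℕ → ℝ := fun k =>
  if k = 0 then 1 / 4 else if k = 4 then 1 / 6 else if k = 5 then 5 / 24 else if k = 6 then 1 / 6 else if k = 7 then 5 / 24 else 0

/-- the gated first factor of the witness. -/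
private theorem gate_mu1 : gate mu1 (3 / 4) = nu1 := by
  funext k; simp only [gate, mu1, nu1]
  by_cases h0 : k = 0
  · subst h0; norm_num
  · by_cases h3 : k = 3
    · subst h3; norm_num
    · by_cases h4 : k = 4
      · subst h4; norm_num
      · simp [h0, h3, h4]

/-- the gated second factor of the witness. -/
private theorem gate_mu2 : gate mu2 (3 / 4) = nu2 := by
  funext k; simp only [gate, mu2, nu2]
  by_cases h0 : k = 0
  · subst h0; norm_num
  · by_cases h1 : k = 1
    · subst h1; norm_num
    · by_cases h3 : k = 3
      · subst h3; norm_num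
      · simp [h0, h1, h3]

/-- the convolution of the witness factors. -/
private theorem lconv_mu : lconv 4 3 mu1 mu2 = fun k =>
    if k = 4 then 2 / 9 else if k = 5 then 5 / 18 else if k = 6 then 2 / 9 else if k = 7 then 5 / 18 else 0 := by
  funext k
  simp only [lconv, Finset.sum_range_succ, Finset.sum_range_zero, mu1, mu2]
  norm_num
  by_cases h4 : k = 4
  · subst h4; norm_num
  · by_cases h5 : k = 5
    · subst h5; norm_num
    · by_cases h6 : k = 6
      · subst h6; norm_num
      · by_cases h7 : k = 7
        · subst h7; norm_num
        · have e1 : ¬ (4 = k) := fun h => h4 h.symm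
          have e2 : ¬ (5 = k) := fun h => h5 h.symm
          have e3 : ¬ (6 = k) := fun h => h6 h.symm
          have e4 : ¬ (7 = k) := fun h => h7 h.symm
          simp [h4, h5, h6, h7, e1, e2, e3, e4]

/-- the gated convolution of the witness factors. -/
private theorem gate_lconv_mu : gate (lconv 4 3 mu1 mu2) (3 / 4) = pp := by
  rw [lconv_mu]
  funext k; simp only [gate, pp]
  by_cases h0 : k = 0
  · subst h0; norm_num
  · by_cases h4 : k = 4
    · subst h4; norm_num
    · by_cases h5 : k = 5
      · subst h5; norm_num
      · by_cases h6 : k = 6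
        · subst h6; norm_num
        · by_cases h7 : k = 7
          · subst h7; norm_num
          · simp [h0, h4, h5, h6, h7]

/-- **THE CONE FORM OF THE GATED CLOSURE IS FALSE.**  It is NOT true that for all floors `0 < y < 1`, gates `0 < q ≤ 1`, targets `T₁, T₂`
with `y·Mᵢ ≤ Tᵢ`, probability laws `μ₁, μ₂` and layers `j < M₁ + M₂`, the window hypotheses `DECAtT y T₁ j″ M₁ (gate μ₁ q)` (`j − M₂ ≤ j″ ≤ j`)
and `DECAtT y T₂ j″ M₂ (gate μ₂ q)` (`j − M₁ ≤ j″ ≤ j`) imply `DECAtT y (T₁ + T₂) j (M₁ + M₂) (gate (lconv M₁ M₂ μ₁ μ₂) q)`.  Witness: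
`y = 7/12`, `q = 3/4`, `μ₁ = {3: 4/9, 4: 5/9}`, `T₁ = 8/3`, `μ₂ = {1: 1/2, 3: 1/2}`, `T₂ = 7/4` (a quarter above the mean of `gate_q μ₂`), `j = 6`
(module docstring).  Hence `SingleGateConvClosed` is stated at the means. [this work] -/
theorem not_gatedConv_coneForm : ¬ (∀ (y q T₁ T₂ : ℝ) (M₁ M₂ j : ℕ) (μ₁ μ₂ : ℕ → ℝ),
    0 < y → y < 1 → 0 < q → q ≤ 1 →
    (∀ h, 0 ≤ μ₁ h) → (∀ h, M₁ < h → μ₁ h = 0) → (∑ h ∈ Finset.range (M₁ + 1), μ₁ h = 1) → y * (M₁ : ℝ) ≤ T₁ →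
    (∀ h, 0 ≤ μ₂ h) → (∀ h, M₂ < h → μ₂ h = 0) → (∑ h ∈ Finset.range (M₂ + 1), μ₂ h = 1) → y * (M₂ : ℝ) ≤ T₂ →
    j < M₁ + M₂ →
    (∀ j'', j'' ≤ j → j ≤ j'' + M₂ → DECAtT y T₁ j'' M₁ (gate μ₁ q)) →
    (∀ j'', j'' ≤ j → j ≤ j'' + M₁ → DECAtT y T₂ j'' M₂ (gate μ₂ q)) →
    DECAtT y (T₁ + T₂) j (M₁ + M₂) (gate (lconv M₁ M₂ μ₁ μ₂) q)) := by
  intro H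
  have hy0 : (0 : ℝ) < 7 / 12 := by norm_num
  have hy1 : (7 : ℝ) / 12 < 1 := by norm_num
  -- law facts
  have h10 : ∀ h, 0 ≤ mu1 h := fun h => by simp only [mu1]; split_ifs <;> norm_num
  have h1M : ∀ h, 4 < h → mu1 h = 0 := fun h hh => by simp only [mu1]; rw [if_neg (by omega), if_neg (by omega)]
  have h11 : ∑ h ∈ Finset.range (4 + 1), mu1 h = 1 := by simp [Finset.sum_range_succ, mu1]; norm_num
  have h20 : ∀ h, 0 ≤ mu2 h := fun h => by simp only [mu2]; split_ifs <;> norm_num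
  have h2M : ∀ h, 3 < h → mu2 h = 0 := fun h hh => by simp only [mu2]; rw [if_neg (by omega), if_neg (by omega)]
  have h21 : ∑ h ∈ Finset.range (3 + 1), mu2 h = 1 := by simp [Finset.sum_range_succ, mu2]; norm_num
  -- gated factor 1: `nu1` at target `8/3`, single low `0`, layers `3..6`
  have n10 : ∀ k, 0 ≤ nu1 k := fun k => by simp only [nu1]; split_ifs <;> norm_num
  have n1M : ∀ k, 4 < k → nu1 k = 0 := fun k hk => by
    simp only [nu1]; rw [if_neg (by omega), if_neg (by omega), if_neg (by omega)]
  have n11 : ∑ h ∈ Finset.range (4 + 1), nu1 h = 1 := by simp [Finset.sum_range_succ, nu1]; norm_num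
  have n1single : ∀ jj k : ℕ, k ≤ jj → 2 * (k : ℝ) < 8 / 3 → k ≠ 0 → nu1 k = 0 := by
    intro jj k _ hk hk0
    have : k < 2 := by
      by_contra hge
      have : (2 : ℝ) ≤ k := by exact_mod_cast not_lt.1 hge
      linarith
    simp only [nu1]; rw [if_neg hk0, if_neg (by omega), if_neg (by omega)]
  have hyp1 : ∀ jj, 3 ≤ jj → jj ≤ 6 → DECAtT (7 / 12) (8 / 3) jj 4 nu1 := by
    intro jj hj3 hj6
    refine (decAtT_singleLow_iff (7 / 12) (8 / 3) jj 4 0 nu1 hy0 hy1 n10 n1M n11 (Nat.zero_le _) (by norm_num)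
      (n1single jj)).2 ?_
    -- capacity: atom 3 is a compatible heavy mid (C = 7/40), atom 4 is a giant at layer 3 (C = 1) and a heavy mid (C = 7/10) above
    have c0 : capCoef (7 / 12) (8 / 3) jj 0 0 = 0 := capCoef_zero_self (7 / 12) (8 / 3) jj (by norm_num)
    have c3 := capCoef0_eq_heavy (7 / 12) (8 / 3) jj 3 hy0 hy1 (by omega) (by norm_num) (by norm_num) (by norm_num)
    simp only [Finset.sum_range_succ, Finset.sum_range_zero, nu1]
    rw [c0, c3]
    by_cases hj : jj = 3
    · subst hj
      rw [capCoef_giant (7 / 12) (8 / 3) 3 0 4 (by norm_num)]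
      norm_num
    · have c4 := capCoef0_eq_heavy (7 / 12) (8 / 3) jj 4 hy0 hy1 (by omega) (by norm_num) (by norm_num) (by norm_num)
      rw [c4]
      norm_num
  -- gated factor 2: `nu2` at target `7/4` (mean `3/2` plus `1/4`), single low `0`, layers `2..6`
  have n20 : ∀ k, 0 ≤ nu2 k := fun k => by simp only [nu2]; split_ifs <;> norm_num
  have n2M : ∀ k, 3 < k → nu2 k = 0 := fun k hk => by
    simp only [nu2]; rw [if_neg (by omega), if_neg (by omega), if_neg (by omega)]
  have n21 : ∑ h ∈ Finset.range (3 + 1), nu2 h = 1 := by simp [Finset.sum_range_succ, nu2]; norm_num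
  have n2single : ∀ jj k : ℕ, k ≤ jj → 2 * (k : ℝ) < 7 / 4 → k ≠ 0 → nu2 k = 0 := by
    intro jj k _ hk hk0
    have : k < 1 := by
      by_contra hge
      have : (1 : ℝ) ≤ k := by exact_mod_cast not_lt.1 hge
      linarith
    exact absurd (show k = 0 by omega) hk0
  have hyp2 : ∀ jj, 2 ≤ jj → jj ≤ 6 → DECAtT (7 / 12) (7 / 4) jj 3 nu2 := by
    intro jj hj2 hj6
    refine (decAtT_singleLow_iff (7 / 12) (7 / 4) jj 3 0 nu2 hy0 hy1 n20 n2M n21 (Nat.zero_le _) (by norm_num)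
      (n2single jj)).2 ?_
    have c0 : capCoef (7 / 12) (7 / 4) jj 0 0 = 0 := capCoef_zero_self (7 / 12) (7 / 4) jj (by norm_num)
    have c1 : capCoef (7 / 12) (7 / 4) jj 0 1 = 0 := capCoef_zero_mid_incompat (7 / 12) (7 / 4) jj 1 (by omega) (by norm_num)
    simp only [Finset.sum_range_succ, Finset.sum_range_zero, nu2]
    rw [c0, c1]
    by_cases hj : jj = 2
    · subst hj
      rw [capCoef_giant (7 / 12) (7 / 4) 2 0 3 (by norm_num)]
      norm_num
    · have c3 := capCoef0_eq_heavy (7 / 12) (7 / 4) jj 3 hy0 hy1 (by omega) (by norm_num) (by norm_num) (by norm_num)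
      rw [c3]
      norm_num
  -- apply the (false) cone form
  have hP := H (7 / 12) (3 / 4) (8 / 3) (7 / 4) 4 3 6 mu1 mu2 hy0 hy1 (by norm_num) (by norm_num)
    h10 h1M h11 (by norm_num) h20 h2M h21 (by norm_num) (by norm_num)
    (fun jj hj hj' => by rw [gate_mu1]; exact hyp1 jj (by omega) hj)
    (fun jj hj hj' => by rw [gate_mu2]; exact hyp2 jj (by omega) hj)
  rw [gate_lconv_mu] at hP
  -- the conclusion fails: single low `0` at layer 6, target `53/12`; capacity 1051/3180 < 1113/3180
  have p0 : ∀ k, 0 ≤ pp k := fun k => by simp only [pp]; split_ifs <;> norm_num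
  have pM : ∀ k, 4 + 3 < k → pp k = 0 := fun k hk => by
    simp only [pp]; rw [if_neg (by omega), if_neg (by omega), if_neg (by omega), if_neg (by omega), if_neg (by omega)]
  have p1 : ∑ h ∈ Finset.range (4 + 3 + 1), pp h = 1 := by simp [Finset.sum_range_succ, pp]; norm_num
  have psingle : ∀ k : ℕ, k ≤ 6 → 2 * (k : ℝ) < 8 / 3 + 7 / 4 → k ≠ 0 → pp k = 0 := by
    intro k _ hk hk0
    have : k < 3 := by
      by_contra hge
      have : (3 : ℝ) ≤ k := by exact_mod_cast not_lt.1 hge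
      linarith
    simp only [pp]; rw [if_neg hk0, if_neg (by omega), if_neg (by omega), if_neg (by omega), if_neg (by omega)]
  have hcap := (decAtT_singleLow_iff (7 / 12) (8 / 3 + 7 / 4) 6 (4 + 3) 0 pp hy0 hy1 p0 pM p1 (Nat.zero_le _) (by norm_num)
    psingle).1 hP
  have c0 : capCoef (7 / 12) (8 / 3 + 7 / 4) 6 0 0 = 0 := capCoef_zero_self (7 / 12) (8 / 3 + 7 / 4) 6 (by norm_num)
  have c4 : capCoef (7 / 12) (8 / 3 + 7 / 4) 6 0 4 = 0 := capCoef_zero_mid_incompat (7 / 12) (8 / 3 + 7 / 4) 6 4 (by norm_num) (by norm_num)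
  have c5 := capCoef0_eq_heavy (7 / 12) (8 / 3 + 7 / 4) 6 5 hy0 hy1 (by norm_num) (by norm_num) (by norm_num) (by norm_num)
  have c6 := capCoef0_eq_heavy (7 / 12) (8 / 3 + 7 / 4) 6 6 hy0 hy1 (by norm_num) (by norm_num) (by norm_num) (by norm_num)
  have c7 : capCoef (7 / 12) (8 / 3 + 7 / 4) 6 0 7 = 1 := capCoef_giant (7 / 12) (8 / 3 + 7 / 4) 6 0 7 (by norm_num)
  simp only [Finset.sum_range_succ, Finset.sum_range_zero, pp] at hcap
  rw [c0, c4, c5, c6, c7] at hcap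
  norm_num at hcap

end LawDec

end Quant

end Summit.CriticalPhenomena.PercolationContinuityZ3.Theorems
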